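import Mathlib
import Literature.MathematicalPhysics.KineticTheory.HardSphereEulerPrimitiveForm
import Literature.Analysis.FunctionSpaces.TorusSpaceTime
import HarnessLib

/-!
# Crux `NearConstantShortTimeHL` (stmt-AtomisticToContinuum-12502), line `small-tilt-domination`:
# helpers for the stub `entropyFlux_remainder_bound` (part A)

Elementary inputs of the Dafermos quadratic-remainder estimate for the hard-sphere Euler system
(`RelayRaceLocalityNearConstantShortTimeHLEntropyFluxRemainder.lean`), kept in a separate file
to respect the 400-line bound:

* `exists_horizon_of_packing_lt` (registered intermediate stub, W1): if the packing `ρσ³` of a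
  classical solution is `< η₀` on `[0, t] × 𝕋³`, `t < T`, it stays `< η₀` on a slab
  `[0, T') × 𝕋³` with `t < T' ≤ T` (tube lemma over the compact torus);
* `Ico_eventuallyEq_Ico_of_lt_of_le`: `[0, T)` and `[0, T')` agree near `r < T' ≤ T`;
* `abs_fluct_le`, `two_mul_energy_sub_norm_sq`, `abs_totalEnergyDensity_le`, `prim_sq_le`:
  the conserved increments `(ρ' - ρ, m' - ρu, E' - E)` control the primitive increments
  `(ρ' - ρ, m'/ρ' - u, θ(W) - θ)` quadratically near a state with `ρ, θ` bounded away from `0`.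

No definitions, no named facts.
-/

noncomputable section

namespace Summit.AtomisticToContinuum.HydrodynamicLimit.Theorems.NearConstantShortTimeHL

open scoped BigOperators ENNReal Topology InnerProductSpace
open MeasureTheory Set Filter
open Literature.MathematicalPhysics.KineticTheory Literature.Analysis.FluidPDE Literature.Analysis.FunctionSpaces

/-! ### A slab `[0, T')` beyond `t` on which the packing bound persists -/

/-- **Tube step.** If the packing `ρσ³` of a classical solution is `< η₀` on `[0, t] × 𝕋³`,
`t < T`, then it is `< η₀` on a whole slab `[0, T') × 𝕋³` with `t < T' ≤ T` (the density is
jointly continuous and `𝕋³` is compact). [folklore] -/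
theorem exists_horizon_of_packing_lt : ∀ {σ T η₀ t : ℝ} {ρ θ : ℝ → T3 → ℝ} {u : ℝ → T3 → V3}, IsHardSphereEulerSolution σ T ρ u θ → 0 < σ → t ∈ Set.Ico 0 T → (∀ s ∈ Set.Icc 0 t, ∀ x, ρ s x * σ ^ 3 < η₀) → ∃ T' : ℝ, t < T' ∧ T' ≤ T ∧ ∀ s ∈ Set.Ico 0 T', ∀ x, ρ s x * σ ^ 3 < η₀ := by
  intro σ T η₀ t ρ θ u hE hσ ht hpack
  have hσ3 : 0 < σ ^ 3 := pow_pos hσ 3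
  obtain ⟨x₀, -, hx₀⟩ := isCompact_univ.exists_isMaxOn univ_nonempty
    ((hE.smooth_density.isSmooth_slice ht).continuous.continuousOn)
  have hε : 0 < η₀ / σ ^ 3 - ρ t x₀ := by
    have h := hpack t ⟨ht.1, le_rfl⟩ x₀
    rw [sub_pos, lt_div_iff₀ hσ3]
    exact h
  have hev := hE.smooth_density.eventually_norm_sub_lt ht hε
  rw [eventually_nhdsWithin_iff, Metric.eventually_nhds_iff] at hev
  obtain ⟨δ, hδ, hδP⟩ := hev
  refine ⟨min T (t + δ), lt_min ht.2 (by linarith), min_le_left _ _, fun s hs x => ?_⟩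
  rcases le_or_gt s t with hst | hst
  · exact hpack s ⟨hs.1, hst⟩ x
  · have hsT : s ∈ Ico 0 T := ⟨hs.1, hs.2.trans_le (min_le_left _ _)⟩
    have hsδ : dist s t < δ := by
      rw [Real.dist_eq, abs_of_pos (sub_pos.2 hst)]
      linarith [hs.2.trans_le (min_le_right _ _)]
    have h := hδP hsδ hsT x
    rw [Real.norm_eq_abs, abs_lt] at h
    have hmax : ρ t x ≤ ρ t x₀ := hx₀ (mem_univ x)
    rw [← lt_div_iff₀ hσ3]
    linarith [h.2]

/-- Near `r < T' ≤ T` the time sets `[0, T)` and `[0, T')` coincide, so one-sided time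
derivatives within them agree at `r` (Mathlib `derivWithin_congr_set`). [folklore] -/
theorem Ico_eventuallyEq_Ico_of_lt_of_le {T T' r : ℝ} (hr : r < T') (hT : T' ≤ T) :
    (Ico 0 T : Set ℝ) =ᶠ[𝓝 r] (Ico 0 T' : Set ℝ) := by
  refine Filter.eventuallyEq_set.2 ?_
  filter_upwards [Iio_mem_nhds hr] with τ hτ
  exact ⟨fun h => ⟨h.1, hτ⟩, fun h => ⟨h.1, h.2.trans_le hT⟩⟩

/-! ### Elementary estimates: conserved versus primitive increments -/

/-- The fluctuation `X = 2ρe + 2aE + 2ae - 2ρι - n²` of `2ρ'E' - |m'|²` around `3ρ²θ`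
(`a = ρ' - ρ`, `e = E' - E`, `n = |m' - ρu|`, `ι = u·(m' - ρu)`) is at most
`11 L³ (|a| + n + |e|)` when `|ρ| ≤ L`, `|E| ≤ 2L³`, `|ι| ≤ L n`, `L ≥ 1` and the increments are
`≤ 1`. [folklore] -/
theorem abs_fluct_le {ρ E a e n ι L : ℝ} (hL : 1 ≤ L) (hρ : |ρ| ≤ L) (hE : |E| ≤ 2 * L ^ 3)
    (hι : |ι| ≤ L * n) (hn0 : 0 ≤ n) (he : |e| ≤ 1) (hn : n ≤ 1) :
    |2 * ρ * e + 2 * a * E + 2 * a * e - 2 * ρ * ι - n ^ 2| ≤ 11 * L ^ 3 * (|a| + n + |e|) := by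
  have hL3 : L ≤ L ^ 3 := le_self_pow₀ hL (by norm_num)
  have hL23 : L ^ 2 ≤ L ^ 3 := pow_le_pow_right₀ hL (by norm_num)
  have hL13 : 1 ≤ L ^ 3 := hL.trans hL3
  have e1 : |ρ * e| ≤ L * |e| := by
    rw [abs_mul]; exact mul_le_mul_of_nonneg_right hρ (abs_nonneg _)
  have e2 : |a * E| ≤ |a| * (2 * L ^ 3) := by
    rw [abs_mul]; exact mul_le_mul_of_nonneg_left hE (abs_nonneg _)
  have e3 : |a * e| ≤ |a| * 1 := by
    rw [abs_mul]; exact mul_le_mul_of_nonneg_left he (abs_nonneg _)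
  have e4 : |ρ * ι| ≤ L * (L * n) := by
    rw [abs_mul]; exact mul_le_mul hρ hι (abs_nonneg _) (by linarith only [hL])
  have e5 : n ^ 2 ≤ n := by nlinarith only [hn0, hn]
  have f1 : L * |e| ≤ L ^ 3 * |e| := mul_le_mul_of_nonneg_right hL3 (abs_nonneg _)
  have f2 : |a| * 1 ≤ L ^ 3 * |a| := by nlinarith only [hL13, abs_nonneg a]
  have f3 : L * (L * n) ≤ L ^ 3 * n := by
    have h := mul_le_mul_of_nonneg_right hL23 hn0
    linarith only [h]
  have f4 : n ≤ L ^ 3 * n := le_mul_of_one_le_left hn0 hL13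
  rw [abs_le] at e1 e2 e3 e4 ⊢
  constructor <;> linarith only [e1.1, e1.2, e2.1, e2.2, e3.1, e3.2, e4.1, e4.2, e5, f1, f2, f3,
    f4, hn0, abs_nonneg a, abs_nonneg e, sq_nonneg n]

/-- `2ρ'E' - |m'|² = 3ρ²θ + X` with the fluctuation `X` of `abs_fluct_le`, for
`E = ρ(|u|²/2 + 3θ/2)` (expand `|ρu + (m' - ρu)|²`). [folklore] -/
theorem two_mul_energy_sub_norm_sq (ρ θ ρ' E' : ℝ) (u m' : V3) :
    2 * ρ' * E' - ‖m'‖ ^ 2 = 3 * ρ ^ 2 * θ +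
      (2 * ρ * (E' - totalEnergyDensity ρ u θ) + 2 * (ρ' - ρ) * totalEnergyDensity ρ u θ +
        2 * (ρ' - ρ) * (E' - totalEnergyDensity ρ u θ) - 2 * ρ * ⟪u, m' - ρ • u⟫_ℝ -
        ‖m' - ρ • u‖ ^ 2) := by
  have hd : m' = ρ • u + (m' - ρ • u) := by abel
  have hns : ‖m'‖ ^ 2 = ρ ^ 2 * ‖u‖ ^ 2 + 2 * (ρ * ⟪u, m' - ρ • u⟫_ℝ) + ‖m' - ρ • u‖ ^ 2 := by
    conv_lhs => rw [hd]
    rw [norm_add_sq_real, norm_smul, real_inner_smul_left, Real.norm_eq_abs, mul_pow, sq_abs]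
  rw [hns]
  simp only [totalEnergyDensity]
  ring

/-- Bound of the total energy density: `|E| ≤ 2L³` when `|ρ|, |u|, |θ| ≤ L`, `L ≥ 1`.
[folklore] -/
theorem abs_totalEnergyDensity_le {ρ θ L : ℝ} {u : V3} (hL : 1 ≤ L) (hρL : |ρ| ≤ L)
    (huL : ‖u‖ ≤ L) (hθL : |θ| ≤ L) : |totalEnergyDensity ρ u θ| ≤ 2 * L ^ 3 := by
  simp only [totalEnergyDensity, abs_mul]
  have hu2 : ‖u‖ ^ 2 ≤ L ^ 2 := pow_le_pow_left₀ (norm_nonneg u) huL 2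
  have h1 : |‖u‖ ^ 2 / 2 + 3 / 2 * θ| ≤ L ^ 2 / 2 + 3 / 2 * L := by
    calc |‖u‖ ^ 2 / 2 + 3 / 2 * θ| ≤ |‖u‖ ^ 2 / 2| + |3 / 2 * θ| := abs_add_le _ _
      _ ≤ L ^ 2 / 2 + 3 / 2 * L := by
        rw [abs_of_nonneg (by positivity), abs_mul, abs_of_nonneg (by norm_num : (0:ℝ) ≤ 3 / 2)]
        linarith only [hu2, hθL]
  have h2 : L ^ 2 / 2 + 3 / 2 * L ≤ 2 * L ^ 2 := by nlinarith only [hL]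
  calc |ρ| * |‖u‖ ^ 2 / 2 + 3 / 2 * θ| ≤ L * (L ^ 2 / 2 + 3 / 2 * L) :=
        mul_le_mul hρL h1 (abs_nonneg _) (by linarith only [hL])
    _ ≤ L * (2 * L ^ 2) := mul_le_mul_of_nonneg_left h2 (by linarith only [hL])
    _ = 2 * L ^ 3 := by ring

/-- **Primitive increments are controlled by conserved increments** near a state with
`|ρ|, |u|, |θ| ≤ L` (`L ≥ 1`) and `ρ' ≥ y₁/2 > 0`: if
`|ρ' - ρ| + |m' - ρu| + |E' - E| ≤ 1` then
`(ρ' - ρ)² + Σⱼ (m'ⱼ/ρ' - uⱼ)² + (θ(W) - θ)² ≤ C_L ((ρ' - ρ)² + |m' - ρu|² + (E' - E)²)` with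
`θ(W) = (2/3)(E'/ρ' - |m'|²/(2ρ'²))` and `C_L = 1 + 8L²/y₁² + 2400 L⁶/y₁⁴`. [folklore] -/
theorem prim_sq_le {ρ θ ρ' E' L y₁ : ℝ} {u m' : V3} (hL : 1 ≤ L) (hy₁ : 0 < y₁)
    (hρ' : y₁ / 2 ≤ ρ') (hρL : |ρ| ≤ L) (huL : ‖u‖ ≤ L) (hθL : |θ| ≤ L)
    (hsmall : |ρ' - ρ| + ‖m' - ρ • u‖ + |E' - totalEnergyDensity ρ u θ| ≤ 1) :
    (ρ' - ρ) ^ 2 + (ρ'⁻¹ * m' 0 - u 0) ^ 2 + (ρ'⁻¹ * m' 1 - u 1) ^ 2 + (ρ'⁻¹ * m' 2 - u 2) ^ 2 +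
        (2 / 3 * (E' / ρ' - ‖m'‖ ^ 2 / (2 * ρ' ^ 2)) - θ) ^ 2 ≤
      (1 + 8 * L ^ 2 / y₁ ^ 2 + 2400 * L ^ 6 / y₁ ^ 4) *
        ((ρ' - ρ) ^ 2 + ‖m' - ρ • u‖ ^ 2 + (E' - totalEnergyDensity ρ u θ) ^ 2) := by
  -- abbreviations (plain names for the three increments)
  set a : ℝ := ρ' - ρ with ha
  set n : ℝ := ‖m' - ρ • u‖ with hn
  set e : ℝ := E' - totalEnergyDensity ρ u θ with he
  have hn0 : 0 ≤ n := norm_nonneg _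
  have ha1 : |a| ≤ 1 := by linarith only [hsmall, hn0, abs_nonneg e]
  have hn1 : n ≤ 1 := by linarith only [hsmall, abs_nonneg a, abs_nonneg e]
  have he1 : |e| ≤ 1 := by linarith only [hsmall, abs_nonneg a, hn0]
  have hρ'0 : 0 < ρ' := by linarith only [hρ', hy₁]
  have hL2 : 1 ≤ L ^ 2 := one_le_pow₀ hL
  have hL3 : L ≤ L ^ 3 := le_self_pow₀ hL (by norm_num)
  have hinv : ρ'⁻¹ ≤ 2 / y₁ := by
    rw [inv_le_comm₀ hρ'0 (by positivity), inv_div]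
    exact hρ'
  -- (i) the velocity increment `m'/ρ' - u = ρ'⁻¹ (δm - a u)`
  have hns : (ρ'⁻¹ * m' 0 - u 0) ^ 2 + (ρ'⁻¹ * m' 1 - u 1) ^ 2 + (ρ'⁻¹ * m' 2 - u 2) ^ 2 =
      ‖ρ'⁻¹ • m' - u‖ ^ 2 := by
    rw [EuclideanSpace.norm_sq_eq]
    simp only [PiLp.sub_apply, PiLp.smul_apply, smul_eq_mul, Real.norm_eq_abs, sq_abs,
      Fin.sum_univ_three]
  have hb : ρ'⁻¹ • m' - u = ρ'⁻¹ • ((m' - ρ • u) - a • u) := by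
    have h1 : (m' - ρ • u) - a • u = m' - ρ' • u := by
      rw [ha, sub_smul]; abel
    rw [h1, smul_sub, smul_smul, inv_mul_cancel₀ hρ'0.ne', one_smul]
  have hbn : ‖ρ'⁻¹ • m' - u‖ ≤ 2 / y₁ * (n + L * |a|) := by
    rw [hb, norm_smul, Real.norm_eq_abs, abs_of_pos (inv_pos.2 hρ'0)]
    refine mul_le_mul hinv ?_ (norm_nonneg _) (by positivity)
    calc ‖(m' - ρ • u) - a • u‖ ≤ ‖m' - ρ • u‖ + ‖a • u‖ := norm_sub_le _ _
      _ ≤ n + L * |a| := by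
        rw [norm_smul, Real.norm_eq_abs, ← hn]
        have h := mul_le_mul_of_nonneg_left huL (abs_nonneg a)
        linarith only [h]
  have hb2 : ‖ρ'⁻¹ • m' - u‖ ^ 2 ≤ 8 * L ^ 2 / y₁ ^ 2 * (a ^ 2 + n ^ 2) := by
    have h1 := pow_le_pow_left₀ (norm_nonneg _) hbn 2
    refine h1.trans ?_
    have h2 : (n + L * |a|) ^ 2 ≤ 2 * n ^ 2 + 2 * (L * |a|) ^ 2 := by
      linarith only [sq_nonneg (n - L * |a|),
        (by ring : (n + L * |a|) ^ 2 + (n - L * |a|) ^ 2 = 2 * n ^ 2 + 2 * (L * |a|) ^ 2)]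
    have h3 : (L * |a|) ^ 2 = L ^ 2 * a ^ 2 := by rw [mul_pow, sq_abs]
    have h4 : n ^ 2 ≤ L ^ 2 * n ^ 2 := le_mul_of_one_le_left (sq_nonneg _) hL2
    rw [h3] at h2
    have h5 : (n + L * |a|) ^ 2 ≤ 2 * L ^ 2 * (a ^ 2 + n ^ 2) := by linarith only [h2, h4]
    calc (2 / y₁ * (n + L * |a|)) ^ 2 = 4 / y₁ ^ 2 * (n + L * |a|) ^ 2 := by ring
      _ ≤ 4 / y₁ ^ 2 * (2 * L ^ 2 * (a ^ 2 + n ^ 2)) := mul_le_mul_of_nonneg_left h5 (by positivity)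
      _ = 8 * L ^ 2 / y₁ ^ 2 * (a ^ 2 + n ^ 2) := by ring
  -- (ii) the temperature increment: `ρ'² c = X/3 - θ a (2ρ + a)`
  have hEabs : |totalEnergyDensity ρ u θ| ≤ 2 * L ^ 3 := abs_totalEnergyDensity_le hL hρL huL hθL
  have hι : |⟪u, m' - ρ • u⟫_ℝ| ≤ L * n :=
    (abs_real_inner_le_norm _ _).trans (mul_le_mul_of_nonneg_right huL (norm_nonneg _))
  have hX := abs_fluct_le (a := a) hL hρL hEabs hι hn0 he1 hn1
  have hexp := two_mul_energy_sub_norm_sq ρ θ ρ' E' u m'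
  rw [← ha, ← hn, ← he] at hexp
  have hc : 2 / 3 * (E' / ρ' - ‖m'‖ ^ 2 / (2 * ρ' ^ 2)) - θ =
      ((2 * ρ' * E' - ‖m'‖ ^ 2) / 3 - θ * ρ' ^ 2) / ρ' ^ 2 := by
    field_simp
  have hnum : |(2 * ρ' * E' - ‖m'‖ ^ 2) / 3 - θ * ρ' ^ 2| ≤ 7 * L ^ 3 * (|a| + n + |e|) := by
    have hid : (2 * ρ' * E' - ‖m'‖ ^ 2) / 3 - θ * ρ' ^ 2 =
        (2 * ρ * e + 2 * a * totalEnergyDensity ρ u θ + 2 * a * e - 2 * ρ * ⟪u, m' - ρ • u⟫_ℝ -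
          n ^ 2) / 3 - θ * a * (2 * ρ + a) := by
      rw [hexp, ha]; ring
    rw [hid]
    have h2 : |θ * a * (2 * ρ + a)| ≤ L * |a| * (2 * L + 1) := by
      rw [abs_mul, abs_mul]
      refine mul_le_mul (mul_le_mul_of_nonneg_right hθL (abs_nonneg _)) ?_ (abs_nonneg _)
        (by positivity)
      calc |2 * ρ + a| ≤ |2 * ρ| + |a| := abs_add_le _ _
        _ ≤ 2 * L + 1 := by rw [abs_mul, abs_two]; linarith only [hρL, ha1]
    have h3 : L * |a| * (2 * L + 1) ≤ 3 * L ^ 3 * |a| := by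
      have k1 := mul_le_mul_of_nonneg_right hL3 (abs_nonneg a)
      have hLL : L * L ≤ L ^ 3 := by rw [← sq]; exact pow_le_pow_right₀ hL (by norm_num)
      have k2 := mul_le_mul_of_nonneg_right hLL (abs_nonneg a)
      linarith only [k1, k2]
    have h4 : L ^ 3 * |a| ≤ L ^ 3 * (|a| + n + |e|) :=
      mul_le_mul_of_nonneg_left (by linarith only [hn0, abs_nonneg e]) (by positivity)
    have h5 : 0 ≤ L ^ 3 * (|a| + n + |e|) := by positivity
    calc |(2 * ρ * e + 2 * a * totalEnergyDensity ρ u θ + 2 * a * e - 2 * ρ * ⟪u, m' - ρ • u⟫_ℝ -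
            n ^ 2) / 3 - θ * a * (2 * ρ + a)|
        ≤ |(2 * ρ * e + 2 * a * totalEnergyDensity ρ u θ + 2 * a * e - 2 * ρ * ⟪u, m' - ρ • u⟫_ℝ -
            n ^ 2) / 3| + |θ * a * (2 * ρ + a)| := abs_sub _ _
      _ ≤ 11 * L ^ 3 * (|a| + n + |e|) / 3 + 3 * L ^ 3 * |a| := by
          rw [abs_div, abs_of_pos (by norm_num : (0:ℝ) < 3)]
          exact add_le_add (div_le_div_of_nonneg_right hX (by norm_num)) (h2.trans h3)
      _ ≤ 7 * L ^ 3 * (|a| + n + |e|) := by linarith only [h4, h5]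
  have hcabs : |2 / 3 * (E' / ρ' - ‖m'‖ ^ 2 / (2 * ρ' ^ 2)) - θ| ≤
      28 * L ^ 3 / y₁ ^ 2 * (|a| + n + |e|) := by
    rw [hc, abs_div, abs_of_pos (by positivity : (0:ℝ) < ρ' ^ 2), div_le_iff₀ (by positivity)]
    refine hnum.trans ?_
    have hy : y₁ ^ 2 / 4 ≤ ρ' ^ 2 := by
      have h := pow_le_pow_left₀ (by positivity) hρ' 2
      linarith only [h, (by ring : (y₁ / 2) ^ 2 = y₁ ^ 2 / 4)]
    calc 7 * L ^ 3 * (|a| + n + |e|) = 28 * L ^ 3 / y₁ ^ 2 * (|a| + n + |e|) * (y₁ ^ 2 / 4) := by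
          field_simp
          ring
      _ ≤ 28 * L ^ 3 / y₁ ^ 2 * (|a| + n + |e|) * ρ' ^ 2 :=
          mul_le_mul_of_nonneg_left hy (by positivity)
  have hc2 : (2 / 3 * (E' / ρ' - ‖m'‖ ^ 2 / (2 * ρ' ^ 2)) - θ) ^ 2 ≤
      2400 * L ^ 6 / y₁ ^ 4 * (a ^ 2 + n ^ 2 + e ^ 2) := by
    have h1 := pow_le_pow_left₀ (abs_nonneg _) hcabs 2
    rw [sq_abs] at h1
    refine h1.trans ?_
    have h3 : (|a| + n + |e|) ^ 2 ≤ 3 * (a ^ 2 + n ^ 2 + e ^ 2) := by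
      have k := (by ring : (|a| + n + |e|) ^ 2 + ((|a| - n) ^ 2 + (n - |e|) ^ 2 + (|a| - |e|) ^ 2) =
        3 * (|a| ^ 2 + n ^ 2 + |e| ^ 2))
      rw [sq_abs, sq_abs] at k
      linarith only [k, sq_nonneg (|a| - n), sq_nonneg (n - |e|), sq_nonneg (|a| - |e|)]
    have hX0 : 0 ≤ L ^ 6 / y₁ ^ 4 * (a ^ 2 + n ^ 2 + e ^ 2) := by positivity
    have hrw : 2400 * L ^ 6 / y₁ ^ 4 * (a ^ 2 + n ^ 2 + e ^ 2) =
        2400 * (L ^ 6 / y₁ ^ 4 * (a ^ 2 + n ^ 2 + e ^ 2)) := by ring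
    calc (28 * L ^ 3 / y₁ ^ 2 * (|a| + n + |e|)) ^ 2
        = 784 * (L ^ 6 / y₁ ^ 4) * (|a| + n + |e|) ^ 2 := by ring
      _ ≤ 784 * (L ^ 6 / y₁ ^ 4) * (3 * (a ^ 2 + n ^ 2 + e ^ 2)) :=
          mul_le_mul_of_nonneg_left h3 (by positivity)
      _ ≤ 2400 * L ^ 6 / y₁ ^ 4 * (a ^ 2 + n ^ 2 + e ^ 2) := by linarith only [hX0, hrw]
  -- assembly
  have hA0 : 0 ≤ 8 * L ^ 2 / y₁ ^ 2 * e ^ 2 := by positivity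
  calc (ρ' - ρ) ^ 2 + (ρ'⁻¹ * m' 0 - u 0) ^ 2 + (ρ'⁻¹ * m' 1 - u 1) ^ 2 +
        (ρ'⁻¹ * m' 2 - u 2) ^ 2 + (2 / 3 * (E' / ρ' - ‖m'‖ ^ 2 / (2 * ρ' ^ 2)) - θ) ^ 2
      = a ^ 2 + ‖ρ'⁻¹ • m' - u‖ ^ 2 + (2 / 3 * (E' / ρ' - ‖m'‖ ^ 2 / (2 * ρ' ^ 2)) - θ) ^ 2 := by
        rw [← hns, ha]; ring
    _ ≤ (1 + 8 * L ^ 2 / y₁ ^ 2 + 2400 * L ^ 6 / y₁ ^ 4) * (a ^ 2 + n ^ 2 + e ^ 2) := by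
        linarith only [hb2, hc2, hA0, sq_nonneg n, sq_nonneg e]

end Summit.AtomisticToContinuum.HydrodynamicLimit.Theorems.NearConstantShortTimeHL

end
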